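import Literature.NumberTheory.GaloisRepresentations.CohomologicalDimension
import HarnessLib

/-!
# Transport of continuous cohomology along an isomorphism of topological groups
# (cell `b2b-bsdres`, team n1011, row T-EPC = Tate's local Euler–Poincaré characteristic; seat p04 GEN 8; stage D5a)

HONEST FRAMING (cell `b2b-bsdres`, run/shared/lean/b2b/bsd-rank1-residual/, verbatim in every
file): the goal of the cell is to DELETE the COMBINATION-SHAPED residual classes of the
Birch–Swinnerton-Dyer formula for ALL analytic-rank `≤ 1` elliptic curves over `ℚ` — "full BSD
formula for every rank `≤ 1` curve in class `C`" assembled STRICTLY from published theorems — so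
that the rank-`≤ 1` remainder becomes exactly the CONSTRUCTION-SHAPED classes, which are TYPED
(missing-input `Prop`s), NOT attempted. This is not "finishing BSD". Team n1011 (N10 / N11, the
additive block X4 ∧ `p = 3`): research route; no claim beyond the stated classes; nothing is
booked; no mark / label is changed by this file. Theorems only (no definition, no named fact, no
`sorry`).  (Placement: Summits/GaloisImage with the T-EPC cone.)

## What

Glue used in the `ℓ = p` part of Tate's local Euler–Poincaré characteristic formula (Milne,
*ADT* I Thm. 2.8), where the cohomology of an open subgroup `Σ ≤ Γ_K` must be compared with
that of `Γ_{K₁}` (`K₁` the fixed field of `Σ`) and with that of `Σ` seen inside a smaller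
ambient group.  For an isomorphism of topological groups `e : G ≃ₜ* H` and continuous
representations `τ` of `G`, `σ` of `H` on the same module with `τ g = σ (e g)`:

* `EPCTransport.exists_bijective` — a bijection `H^q(G, τ) ≃ H^q(H, σ)` (the maps induced by `e`
  and `e⁻¹`, Mathlib `ContinuousCohomology.map`, compose to the identity: `map_comp`, `map_id`;
  the argument of the tree's `GroupCdLE.of_continuousMulEquiv`);
* `EPCTransport.natCard_continuousCohomology_congr`, `EPCTransport.finite_continuousCohomology_iff`;
* `EPCTransport.invariants_eq`, `EPCTransport.natCard_invariants_congr` — `M^G = M^H`.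

References: J.-P. Serre, *Galois Cohomology* (1997), I §2.2 [SerreGaloisCohomology1997];
J. S. Milne, *Arithmetic Duality Theorems* (2006), I §2 [MilneADT2006].
-/

noncomputable section

open CategoryTheory Function
open Literature.NumberTheory.GaloisRepresentations

universe u

namespace Summit.BirchSwinnertonDyer.Rank1Residual.GaloisImage

namespace EPCTransport

variable {G H : Type u} [Group G] [TopologicalSpace G] [IsTopologicalGroup G]
  [Group H] [TopologicalSpace H] [IsTopologicalGroup H]
variable {M : Type u} [AddCommGroup M] [TopologicalSpace M] [DiscreteTopology M]

/-- **Cohomology is invariant under isomorphisms of topological groups**: for `e : G ≃ₜ* H` and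
representations `τ` of `G`, `σ` of `H` on `M` with `τ g = σ (e g)`, there is a bijection
`H^q(G, τ) → H^q(H, σ)` (induced by `e⁻¹`; its inverse is induced by `e`).
[cite: SerreGaloisCohomology1997, I §2.2] -/
theorem exists_bijective (e : G ≃ₜ* H) (τ : ContinuousRep G ℤ M) (σ : ContinuousRep H ℤ M)
    (hc : ∀ g m, τ g m = σ (e g) m) (q : ℕ) :
    ∃ Φ : continuousCohomology q τ.toTopRep → continuousCohomology q σ.toTopRep, Bijective Φ := by
  have hc' : ∀ h m, σ h m = τ (e.symm h) m := fun h m => by rw [hc, ContinuousMulEquiv.apply_symm_apply]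
  let f : TopRep.res ((e : G →ₜ* H) : G →* H) σ.toTopRep ⟶ τ.toTopRep :=
    TopRep.ofHom ⟨ContinuousLinearMap.id ℤ M, fun g => by
      ext m
      simp [hc]⟩
  let g : TopRep.res ((e.symm : H →ₜ* G) : H →* G) τ.toTopRep ⟶ σ.toTopRep :=
    TopRep.ofHom ⟨ContinuousLinearMap.id ℤ M, fun x => by
      ext m
      simp [hc']⟩
  -- the two composites are identities
  have hcomp₁ : ContinuousCohomology.map (e : G →ₜ* H) f q ≫
      ContinuousCohomology.map (e.symm : H →ₜ* G) g q = 𝟙 _ := by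
    rw [← ContinuousCohomology.map_comp]
    refine continuousCohomology_map_eq_id _ _ ?_ (fun x => rfl) q
    ext x
    simp
  have hcomp₂ : ContinuousCohomology.map (e.symm : H →ₜ* G) g q ≫
      ContinuousCohomology.map (e : G →ₜ* H) f q = 𝟙 _ := by
    rw [← ContinuousCohomology.map_comp]
    refine continuousCohomology_map_eq_id _ _ ?_ (fun x => rfl) q
    ext x
    simp
  have key₁ : ∀ x, (ContinuousCohomology.map (e.symm : H →ₜ* G) g q).hom
      ((ContinuousCohomology.map (e : G →ₜ* H) f q).hom x) = x := fun x => by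
    have hx := congr_arg (fun φ => φ.hom x) hcomp₁
    simpa using hx
  have key₂ : ∀ y, (ContinuousCohomology.map (e : G →ₜ* H) f q).hom
      ((ContinuousCohomology.map (e.symm : H →ₜ* G) g q).hom y) = y := fun y => by
    have hy := congr_arg (fun φ => φ.hom y) hcomp₂
    simpa using hy
  exact ⟨fun y => (ContinuousCohomology.map (e.symm : H →ₜ* G) g q).hom y,
    Function.bijective_iff_has_inverse.2 ⟨fun x => (ContinuousCohomology.map (e : G →ₜ* H) f q).hom x,
      key₂, key₁⟩⟩

/-- `#H^q(G, τ) = #H^q(H, σ)` along `e : G ≃ₜ* H` with `τ g = σ (e g)`.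
[cite: SerreGaloisCohomology1997, I §2.2] -/
theorem natCard_continuousCohomology_congr (e : G ≃ₜ* H) (τ : ContinuousRep G ℤ M)
    (σ : ContinuousRep H ℤ M) (hc : ∀ g m, τ g m = σ (e g) m) (q : ℕ) :
    Nat.card (continuousCohomology q τ.toTopRep) = Nat.card (continuousCohomology q σ.toTopRep) := by
  obtain ⟨Φ, hΦ⟩ := exists_bijective e τ σ hc q
  exact Nat.card_eq_of_bijective Φ hΦ

/-- `H^q(G, τ)` is finite iff `H^q(H, σ)` is, along `e : G ≃ₜ* H` with `τ g = σ (e g)`.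
[cite: SerreGaloisCohomology1997, I §2.2] -/
theorem finite_continuousCohomology_iff (e : G ≃ₜ* H) (τ : ContinuousRep G ℤ M)
    (σ : ContinuousRep H ℤ M) (hc : ∀ g m, τ g m = σ (e g) m) (q : ℕ) :
    Finite (continuousCohomology q τ.toTopRep) ↔ Finite (continuousCohomology q σ.toTopRep) := by
  obtain ⟨Φ, hΦ⟩ := exists_bijective e τ σ hc q
  exact ⟨fun _ => Finite.of_surjective Φ hΦ.2, fun _ => Finite.of_injective Φ hΦ.1⟩

/-- `H^q(H, ·) = 0` on a module transports to `H^q(G, ·) = 0` along `e : G ≃ₜ* H`.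
[cite: SerreGaloisCohomology1997, I §2.2] -/
theorem subsingleton_continuousCohomology (e : G ≃ₜ* H) (τ : ContinuousRep G ℤ M)
    (σ : ContinuousRep H ℤ M) (hc : ∀ g m, τ g m = σ (e g) m) (q : ℕ)
    [hσ : Subsingleton (continuousCohomology q σ.toTopRep)] :
    Subsingleton (continuousCohomology q τ.toTopRep) := by
  obtain ⟨Φ, hΦ⟩ := exists_bijective e τ σ hc q
  exact hΦ.1.subsingleton

omit [IsTopologicalGroup G] [IsTopologicalGroup H] in
/-- Invariants do not change: `M^G = M^H` (as subgroups of `M`) when `τ g = σ (e g)` for a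
bijective `e`. [folklore] -/
theorem invariants_eq (e : G ≃ₜ* H) (τ : ContinuousRep G ℤ M) (σ : ContinuousRep H ℤ M)
    (hc : ∀ g m, τ g m = σ (e g) m) :
    τ.toTopRep.ρ.invariants = σ.toTopRep.ρ.invariants := by
  ext m
  constructor
  · intro h x
    have := h (e.symm x)
    rw [show τ.toTopRep.ρ (e.symm x) m = τ (e.symm x) m from rfl, hc,
      ContinuousMulEquiv.apply_symm_apply] at this
    exact this
  · intro h g
    have := h (e g)
    rw [show σ.toTopRep.ρ (e g) m = σ (e g) m from rfl, ← hc] at this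
    exact this

omit [IsTopologicalGroup G] [IsTopologicalGroup H] in
/-- `#M^G = #M^H` along `e : G ≃ₜ* H` with `τ g = σ (e g)`. [folklore] -/
theorem natCard_invariants_congr (e : G ≃ₜ* H) (τ : ContinuousRep G ℤ M) (σ : ContinuousRep H ℤ M)
    (hc : ∀ g m, τ g m = σ (e g) m) :
    Nat.card τ.toTopRep.ρ.invariants = Nat.card σ.toTopRep.ρ.invariants := by
  rw [invariants_eq e τ σ hc]

/-! ### The two isomorphisms of topological groups used in the tower -/

omit [IsTopologicalGroup G] in
/-- For subgroups `S ≤ T` of a topological group, `S` viewed inside `T` (`S.subgroupOf T`) is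
isomorphic to `S` as a topological group (Mathlib `Subgroup.subgroupOfEquivOfLe` is a
homeomorphism for the subspace topologies). [folklore] -/
theorem exists_continuousMulEquiv_subgroupOf {S T : Subgroup G} (h : S ≤ T) :
    ∃ e : S.subgroupOf T ≃ₜ* S, ∀ x, ((e x : S) : G) = ((x : T) : G) := by
  refine ⟨{ Subgroup.subgroupOfEquivOfLe h with
    continuous_toFun := ?_
    continuous_invFun := ?_ }, fun x => rfl⟩
  · exact Continuous.subtype_mk (continuous_subtype_val.comp continuous_subtype_val) _
  · exact Continuous.subtype_mk (Continuous.subtype_mk continuous_subtype_val _) _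

end EPCTransport

end Summit.BirchSwinnertonDyer.Rank1Residual.GaloisImage

end
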